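import Summits.QuantumFields.QCD.Theses.QuarksNoInfraredClause
import HarnessLib

/-!
# Route `QuarksNoInfraredClause` (QCD): the support items `TwoPointWitness` (stmt-QuantumFields-9510) and
`ThreePointWitness` (stmt-QuantumFields-9511)

LIMIT GLUE FOR NON-TRIVIALITY / NON-GAUSSIANITY (cards P2(b), P2(c)): for any scheme, OS data `T` and species `s`,
`IsQCDAlong sch T` and the lattice-side connected 2-point (resp. 3-point) non-degeneracy of `s` on real bumps in disjoint
time slabs imply `T.IsNontrivial s` (resp. `T.IsNonGaussian s`): tensors of real bumps in disjoint closed time slabs are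
off-diagonal, `IsQCDAlong` identifies the limits, and a sequence eventually `≥ ε` in norm has a non-zero limit.
The argument is VERBATIM the one already kernel-checked INSIDE the route's deciding theorem
`Summit.QuantumFields.QCD.Theses.QuarksNoInfraredClause.closes` (its local `h₃`, `h₄`); it is extracted here as named
theorems so that the two support items close by name.  Nothing is asserted about QCD beyond that; no summit, leg or crux
statement is proved (width seat ym-t4-w17 g0, free hands; the items carried an unlanded candidate proof of 2026-08-16 by the
route-repair planner, unreadable from this seat).
-/

set_option autoImplicit false

namespace Summit.QuantumFields.QCD.Theorems

open scoped BigOperators Topology Manifold Classical MeasureTheory ProbabilityTheory Matrix InnerProductSpace ComplexConjugate ContinuousMap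
open Filter Set Function TopologicalSpace MeasureTheory
open Summit.QuantumFields.QCD.Theses.QuarksNoInfraredClause (TwoPointWitness ThreePointWitness)

/-- **Both limit-glue witnesses** — the `h₃`/`h₄` block of the route's `closes`, verbatim.
[cite: GlimmJaffe1987, §6.1] [folklore] -/
theorem twoPointWitness_and_threePointWitness : TwoPointWitness ∧ ThreePointWitness := by
  let oR : SchwartzMap (EuclideanSpace ℝ (Fin 4)) ℝ →L[ℝ] SchwartzMap (EuclideanSpace ℝ (Fin 4)) ℂ := Literature.MathematicalPhysics.QuantumLattice.ofRealTest
  let tF : (n : ℕ) → (Fin n → SchwartzMap (EuclideanSpace ℝ (Fin 4)) ℝ) → SchwartzMap (Fin n → EuclideanSpace ℝ (Fin 4)) ℂ :=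
    fun n f => SchwartzMap.tensorFin n fun i => oR (f i)
  have hsupp : ∀ {n : ℕ} (f : Fin n → SchwartzMap (EuclideanSpace ℝ (Fin 4)) ℝ) {x}, x ∈ tsupport (tF n f) → ∀ i, x i ∈ tsupport (f i) := by
    intro n f x hx i
    by_contra hi
    have h1 : ∀ᶠ y in 𝓝 x, f i (y i) = 0 :=
      ((continuous_apply i).tendsto x).eventually (notMem_tsupport_iff_eventuallyEq.mp hi)
    refine (notMem_tsupport_iff_eventuallyEq.mpr ?_) hx
    filter_upwards [h1] with y hy
    simp only [tF, oR, Pi.zero_apply, SchwartzMap.tensorFin_apply, Literature.MathematicalPhysics.QuantumLattice.ofRealTest_apply]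
    exact Finset.prod_eq_zero (Finset.mem_univ i) (by rw [hy]; simp)
  have hoff : ∀ {n : ℕ} (f : Fin n → SchwartzMap (EuclideanSpace ℝ (Fin 4)) ℝ),
      (∀ i j, i ≠ j → ∀ z, z ∈ tsupport (f i) → z ∈ tsupport (f j) → False) →
      Literature.MathematicalPhysics.AQFT.IsOffDiagonal (tF n f) :=
    fun f hsep => Literature.MathematicalPhysics.AQFT.IsOffDiagonal.of_tsupport_subset fun x hx hmem => by
      obtain ⟨i, j, hij, hxij⟩ := hmem
      exact hsep i j hij (x i) (hsupp f hx i) (hxij ▸ hsupp f hx j)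
  have hoff1 : ∀ a : SchwartzMap (EuclideanSpace ℝ (Fin 4)) ℝ, Literature.MathematicalPhysics.AQFT.IsOffDiagonal (tF 1 ![a]) :=
    fun a => hoff ![a] fun i j hij _ _ _ => hij (Subsingleton.elim i j)
  have hoff2 : ∀ a b : SchwartzMap (EuclideanSpace ℝ (Fin 4)) ℝ, (∀ z, z ∈ tsupport a → z ∈ tsupport b → False) →
      Literature.MathematicalPhysics.AQFT.IsOffDiagonal (tF 2 ![a, b]) := by
    intro a b hab
    refine hoff ![a, b] fun i j hij z hzi hzj => ?_
    fin_cases i <;> fin_cases j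
    · exact hij rfl
    · exact hab z hzi hzj
    · exact hab z hzj hzi
    · exact hij rfl
  have hto : ∀ g : SchwartzMap (EuclideanSpace ℝ (Fin 4)) ℝ, tsupport g ⊆ {x | 0 < x 0} → Literature.MathematicalPhysics.QuantumLattice.IsTimeOrdered (tF 1 ![g]) := by
    intro g hg x hx
    refine ⟨fun i => ?_, fun i j hij => absurd (Fin.lt_def.mp hij) (by omega)⟩
    have h := hsupp ![g] hx i
    simp only [Matrix.cons_val_fin_one] at h
    exact hg h
  have hsl : ∀ (a b : SchwartzMap (EuclideanSpace ℝ (Fin 4)) ℝ) (P Q : ℝ → Prop), tsupport a ⊆ {x | P (x 0)} → tsupport b ⊆ {x | Q (x 0)} →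
      (∀ t, P t → Q t → False) → ∀ z, z ∈ tsupport a → z ∈ tsupport b → False :=
    fun a b P Q ha hb hPQ z h1 h2 => hPQ _ (ha h1) (hb h2)
  have hs3 : ∀ {ι : Type} (s : ι), (![s, s, s] : Fin 3 → ι) = fun _ => s := fun s => by
    funext i; fin_cases i <;> rfl
  have hs2 : ∀ {ι : Type} (s : ι), (![s, s] : Fin 2 → ι) = fun _ => s := fun s => by
    funext i; fin_cases i <;> rfl
  have hs1 : ∀ {ι : Type} (s : ι), (![s] : Fin 1 → ι) = fun _ => s := fun s => by
    funext i; fin_cases i; rfl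
  have hT : ∀ {n : ℕ} (f : Fin n → SchwartzMap (EuclideanSpace ℝ (Fin 4)) ℝ) (fc : Fin n → SchwartzMap (EuclideanSpace ℝ (Fin 4)) ℂ),
      (∀ i, fc i = oR (f i)) → Literature.MathematicalPhysics.QuantumLattice.IsTensorOf (tF n f) fc := fun f fc hfc x => by
    rw [SchwartzMap.tensorFin_apply]
    exact Finset.prod_congr rfl fun i _ => by rw [hfc i]
  have hlim1 : ∀ {Nf : ℕ} (sch : Literature.MathematicalPhysics.QuantumFieldTheory.QCDScheme Nf) T (s : Literature.MathematicalPhysics.QuantumFieldTheory.QCDField Nf), Literature.MathematicalPhysics.QuantumFieldTheory.IsQCDAlong sch T →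
      ∀ a : SchwartzMap (EuclideanSpace ℝ (Fin 4)) ℝ, Tendsto (fun k => Literature.MathematicalPhysics.QuantumFieldTheory.qcdLatticeSchwinger sch k 1 ![s] ![a]) atTop
        (𝓝 (T.schwinger 1 ![s] (tF 1 ![a]))) :=
    fun sch T s hqcd a => hqcd.2.2 1 one_ne_zero ![s] ![a] _ (Literature.MathematicalPhysics.QuantumLattice.isTensorOf_tensorFin _) (hoff1 a)
  have hlim2 : ∀ {Nf : ℕ} (sch : Literature.MathematicalPhysics.QuantumFieldTheory.QCDScheme Nf) T (s : Literature.MathematicalPhysics.QuantumFieldTheory.QCDField Nf), Literature.MathematicalPhysics.QuantumFieldTheory.IsQCDAlong sch T →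
      ∀ a b : SchwartzMap (EuclideanSpace ℝ (Fin 4)) ℝ, (∀ z, z ∈ tsupport a → z ∈ tsupport b → False) →
      Tendsto (fun k => Literature.MathematicalPhysics.QuantumFieldTheory.qcdLatticeSchwinger sch k 2 ![s, s] ![a, b]) atTop
        (𝓝 (T.schwinger 2 ![s, s] (tF 2 ![a, b]))) :=
    fun sch T s hqcd a b hab =>
      hqcd.2.2 2 two_ne_zero ![s, s] ![a, b] _ (Literature.MathematicalPhysics.QuantumLattice.isTensorOf_tensorFin _) (hoff2 a b hab)
  -- support item TwoPointWitness, proved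
  have h₃ : TwoPointWitness := by
    intro Nf sch T s hqcd hw
    obtain ⟨f, g, hf, hg, ε, hε, hev⟩ := hw
    have hfg := hsl f g (· < 0) (0 < ·) hf hg fun t a b => by linarith
    let F := tF 1 ![Literature.MathematicalPhysics.QuantumLattice.thetaTest 4 f]
    have hadj : Literature.MathematicalPhysics.QuantumLattice.osAdjoint F = tF 1 ![f] := by
      ext x
      rw [Literature.MathematicalPhysics.QuantumLattice.osAdjoint_apply]
      simp [F, tF, oR, SchwartzMap.tensorFin_apply, Literature.MathematicalPhysics.QuantumLattice.thetaTest_apply,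
        Literature.MathematicalPhysics.QuantumLattice.timeReflection_timeReflection]
    have hH : Literature.MathematicalPhysics.QuantumLattice.IsAppendTensorOf (n := 1) (m := 1) (tF 2 ![f, g]) (Literature.MathematicalPhysics.QuantumLattice.osAdjoint F) (tF 1 ![g]) := by
      intro x
      rw [hadj]
      simp [tF, SchwartzMap.tensorFin_apply, Fin.prod_univ_two]
    have hFto : Literature.MathematicalPhysics.QuantumLattice.IsTimeOrdered F := by
      refine hto _ fun x hx => ?_
      have hx' : x ∈ tsupport (fun y => f (Literature.MathematicalPhysics.QuantumLattice.timeReflection 4 y)) := by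
        have : ((Literature.MathematicalPhysics.QuantumLattice.thetaTest 4 f : SchwartzMap (EuclideanSpace ℝ (Fin 4)) ℝ) : EuclideanSpace ℝ (Fin 4) → ℝ) = fun y => f (Literature.MathematicalPhysics.QuantumLattice.timeReflection 4 y) :=
          funext fun y => Literature.MathematicalPhysics.QuantumLattice.thetaTest_apply 4 f y
        rwa [this] at hx
      have h := hf (Literature.MathematicalPhysics.QuantumLattice.tsupport_schwartz_comp_subset f (Literature.MathematicalPhysics.QuantumLattice.timeReflection 4).continuous hx')
      simp [Literature.MathematicalPhysics.QuantumLattice.timeReflection_apply] at h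
      exact h
    have hlim := (hlim2 sch T s hqcd f g hfg).sub ((hlim1 sch T s hqcd f).mul (hlim1 sch T s hqcd g))
    have hle := ge_of_tendsto hlim.norm hev
    have hne : T.schwinger 2 ![s, s] (tF 2 ![f, g]) -
        T.schwinger 1 ![s] (tF 1 ![f]) * T.schwinger 1 ![s] (tF 1 ![g]) ≠ 0 := by
      intro h0; rw [h0, norm_zero] at hle; linarith
    rw [hs2 s, hs1 s] at hne
    refine ⟨F, tF 1 ![g], tF 2 ![f, g], hFto, hto g hg, hH, ?_⟩
    change T.schwinger 2 (fun _ => s) (tF 2 ![f, g]) ≠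
      T.schwinger 1 (fun _ => s) (Literature.MathematicalPhysics.QuantumLattice.osAdjoint F) * T.schwinger 1 (fun _ => s) (tF 1 ![g])
    rw [hadj]
    exact sub_ne_zero.mp hne
  -- support item ThreePointWitness, proved
  have h₄ : ThreePointWitness := by
    intro Nf sch T s hqcd hw
    obtain ⟨f, g, h, hf, hg, hh, ε, hε, hev⟩ := hw
    have hfg := hsl f g (· < 0) (fun t => 0 < t ∧ t < 1) hf hg fun t a b => by linarith [b.1]
    have hfh := hsl f h (· < 0) (1 < ·) hf hh fun t a b => by linarith
    have hgh := hsl g h (fun t => 0 < t ∧ t < 1) (1 < ·) hg hh fun t a b => by linarith [a.2]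
    have h3off : Literature.MathematicalPhysics.AQFT.IsOffDiagonal (tF 3 ![f, g, h]) := by
      refine hoff ![f, g, h] fun i j hij z hzi hzj => ?_
      fin_cases i <;> fin_cases j
      · exact hij rfl
      · exact hfg z hzi hzj
      · exact hfh z hzi hzj
      · exact hfg z hzj hzi
      · exact hij rfl
      · exact hgh z hzi hzj
      · exact hfh z hzj hzi
      · exact hgh z hzj hzi
      · exact hij rfl
    have L3 : Tendsto (fun k => Literature.MathematicalPhysics.QuantumFieldTheory.qcdLatticeSchwinger sch k 3 ![s, s, s] ![f, g, h]) atTop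
        (𝓝 (T.schwinger 3 ![s, s, s] (tF 3 ![f, g, h]))) :=
      hqcd.2.2 3 (by norm_num) ![s, s, s] ![f, g, h] _ (Literature.MathematicalPhysics.QuantumLattice.isTensorOf_tensorFin _) h3off
    have L2 := hlim2 sch T s hqcd
    have L1 := hlim1 sch T s hqcd
    have hlim := (((L3.sub ((L1 f).mul (L2 g h hgh))).sub ((L1 g).mul (L2 f h hfh))).sub
      ((L1 h).mul (L2 f g hfg))).add ((((L1 f).mul (L1 g)).mul (L1 h)).const_mul 2)
    have hle := ge_of_tendsto hlim.norm hev
    have hne : T.schwinger 3 ![s, s, s] (tF 3 ![f, g, h])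
        - T.schwinger 1 ![s] (tF 1 ![f]) * T.schwinger 2 ![s, s] (tF 2 ![g, h])
        - T.schwinger 1 ![s] (tF 1 ![g]) * T.schwinger 2 ![s, s] (tF 2 ![f, h])
        - T.schwinger 1 ![s] (tF 1 ![h]) * T.schwinger 2 ![s, s] (tF 2 ![f, g])
        + 2 * (T.schwinger 1 ![s] (tF 1 ![f]) * T.schwinger 1 ![s] (tF 1 ![g]) *
          T.schwinger 1 ![s] (tF 1 ![h])) ≠ 0 := by
      intro h0; rw [h0, norm_zero] at hle; linarith
    rw [hs3 s, hs2 s, hs1 s] at hne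
    refine ⟨oR f, oR g, oR h, tF 3 ![f, g, h], tF 2 ![g, h], tF 2 ![f, h], tF 2 ![f, g],
      tF 1 ![f], tF 1 ![g], tF 1 ![h], hT _ _ fun i => ?_, h3off, hT _ _ fun i => ?_,
      hT _ _ fun i => ?_, hT _ _ fun i => ?_, hT _ _ fun i => ?_, hT _ _ fun i => ?_,
      hT _ _ fun i => ?_, ?_⟩
    all_goals first | (fin_cases i <;> rfl) | exact hne
  exact ⟨h₃, h₄⟩

/-- **Item stmt-QuantumFields-9510 `QuarksNoInfraredClause.TwoPointWitness` holds.** [folklore] -/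
theorem quarksNoInfraredClause_twoPointWitness_proof :
    Summit.QuantumFields.QCD.Theses.QuarksNoInfraredClause.TwoPointWitness :=
  twoPointWitness_and_threePointWitness.1

/-- **Item stmt-QuantumFields-9511 `QuarksNoInfraredClause.ThreePointWitness` holds** (the non-Gaussianity limit glue,
card P2(c)): the second component of `twoPointWitness_and_threePointWitness`. [folklore] -/
theorem quarksNoInfraredClause_threePointWitness_proof :
    Summit.QuantumFields.QCD.Theses.QuarksNoInfraredClause.ThreePointWitness :=
  twoPointWitness_and_threePointWitness.2

end Summit.QuantumFields.QCD.Theorems
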